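import Mathlib
import HarnessLib
import HarnessLib.Audit
import Summits.QuantumAdvantage.Statement
import Literature.Computability.Complexity.ConstantDepth
import Literature.Computability.Complexity.CircuitClassesUniformProofs
import Literature.Computability.Cryptography.ShorAssemblyLeavesProofs
import Literature.Probability.RandomGraphs.LowDegree
import HarnessLib.Audit.Status.Attr

/-!
Route: MobiusLadder

DORMANT since 2026-08-24T16:00:59Z (reconciler: no traction for 6.9 d (last activity item-evidence-added at 2026-08-17T18:23:07Z); parked, not closed — `ledger route dormant route-QuantumAdvantage-MobiusLadder --off` to reactivate) — unstaffed, not closed; items shared with open routes are served there. `ledger route dormant <id> --off` reactivates.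

# Route QuantumAdvantage/MobiusLadder — Möbius randomness read as a quantum-advantage ladder (idea
card mobius-randomness-ladder)

## Thesis X (target; hypothesis-type, like CircuitLB's ClbFactNotPpoly)
Words: the Liouville language L_λ = { bin(N) : λ(N) = −1 } = { N : Ω(N) odd } (canonical LSB-first
binary encodings,
Mathlib `Computability.encodingNatBool`) has no polynomial-size Boolean circuit family.
Lean:  `Computability.encodingNatBool.toLanguage {N : ℕ | ArithmeticFunction.liouville N = -1} ∉
Literature.Computability.Complexity.PPoly`

## Assembly (X → Statement)
`LiouvilleMemBQP → LiouvilleNotPPoly → QuantumAdvantage`, where `LiouvilleMemBQP : L_λ ∈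
Literature.Computability.Cryptography.BQP`
(Shor: factor N, output the parity of the length of the factor list; support items LiouvilleMemBQP /
ShorToLiouville). One line of
logic through the PROVED Adleman theorem
`Literature.Computability.Complexity.BPP_subset_PPoly_holds` (if no BQP language left BPP,
L_λ ∈ BQP ⊆ BPP ⊆ P/poly); the proof term is checked in the planner's Sketch.lean.

## The ladder under X (the earned content)
λ(N) = (−1)^{Ω(N)} is a TOTAL ±1 function in FBQP (Shor) and the oldest pseudorandom sequence of
number theory. Every
Möbius-randomness theorem "λ is asymptotically orthogonal to all F in a class C of functions of the
binary digits" is an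
unconditional average-case lower bound for a Shor-computable function against C, i.e. a rung "L_λ ∈
BQP ∖ C":
R0  C = AC⁰ — in print (Green2012 Thm 1 + Bourgain2013MoebiusWalsh Thm 1, both stated for λ as
well); earned here as
    WalshLiouvilleBound (crux, the named fact everything rests on) → LiouvilleOrthogonalAC0 (via the
tree's PROVED Tal 2017
    Fourier-tail/L₁ bounds `Circuit.l1Level_acBasis_le`, `tailWeight_le_tailBound`) → L_λ ∉ AC0
(elementary glue);
    side rungs in print: monotone functions (Bourgain2013Walsh Cor 2), finite automata (Mullner2017;
L_λ not regular: Coons2011 Thm 1.5);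
R1  C = AC⁰[⊕] — OPEN: digital low-degree uniformity of λ (cruxes QuadraticDigitPhases ⊂
DigitPolyUniformity) + Razborov–Smolensky glue;
R2  C = TC⁰ — OPEN, the first rung not already witnessed by PARITY/MAJORITY (crux
LiouvilleOrthogonalTC0 → L_λ ∉ TC0);
top X = L_λ ∉ P/poly ⇒ summit. No unconditional path to X is claimed; the bet is the analytic engine
(type I/II sums,
Mauduit–Rivat digit technology, characters to moduli 2^k), which is NON-NATURAL in the
Razborov–Rudich sense.

Rationale: WHY THIS LINE. Imported area: analytic number theory of digital functions (Sarnak's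
Möbius-randomness programme; Green2012,
Bourgain2013MoebiusWalsh, Bourgain2013Walsh, MauduitRivat2015, Mullner2017) pointed at the summit's
non-uniform route (CircuitLB:
BQP ⊄ P/poly via Adleman). Dictionary (explicit, checkable): low-complexity observable ↦ small
circuit class on binary digits;
Möbius disjointness for C ↦ correlation bound ↦ (LMN/Tal, Razborov–Smolensky approximators) L_λ ∉ C;
Shor ↦ failure of the law
for BQP; Chowla ↦ full pseudorandomness. Unlike FACT (CircuitLB) the witness λ comes with PROVED
lower rungs and an engine that has
produced theorems; unlike Shor/AvgCase the hypothesis at the top is a randomness LAW, not "no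
algorithm is known". The tree is
unusually ready: Tal's AC⁰ spectrum bounds, Håstad, PARITY ∉ AC0, BPP ⊆ P/poly, ACC0 ⊆ TC0 are all
PROVED, so R0 and all glue
items are provable now; only WalshLiouvilleBound (in print) and the open rungs need mathematics.

RANKED CRUXES (rank = staffing order; on a ladder informativeness decreases with height while
hardness increases, so after the
base fact the LOWEST open rung comes first):
2 WalshLiouvilleBound — Bourgain 2013 Thm 1 for λ, exponent left free (∃ c > 0): the unproved named
fact the whole ladder rests on
  (Phase-C rule: needed unproved fact = first crux). Earned like route Shor earns Shor's theorem:
Vaughan/type I–II after Mauduit–Rivat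
  for |S| ≳ √n, Green's L(s,χ mod 2^t) argument for small |S|.
3 QuadraticDigitPhases — λ ⊥ (−1)^{P(bits)}, P quadratic over F₂: first case beyond print (linear =
Bourgain; digit-local quadratics
  such as Rudin–Shapiro are automatic, hence MauduitRivat2015/Mullner2017); mirror forms x_i
x_{n−1−i} couple both digit ends and escape
  the carry-propagation technology — a new idea is needed already here.
4 DigitPolyUniformity — the same for total degree ≤ (log₂ n)^A, every A: exactly what
Razborov–Smolensky needs for R1 (support
  LiouvilleNotAC0Xor, ε = 1/16, degree (log₂ n)^{d+1}).
5 LiouvilleOrthogonalTC0 — Möbius randomness for TC⁰ (⇒ L_λ ∉ TC0, support LiouvilleNotTC0):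
breakthrough-type (implies E ⊄ TC⁰,
  beyond Williams2014/MurrayWilliams2018); filed so refuters can attack it (Sarnak's challenge: an
explicit feasible ξ correlating with μ).
Supports (rank 6–13): LiouvilleOrthogonalAC0 (predicate), AC0Rung, LiouvilleNotAC0,
LiouvilleNotAC0Xor, LiouvilleNotTC0,
LiouvilleLangNotRegular (Coons2011), LiouvilleMemBQP, ShorToLiouville; Assembly rank 1.

KILL CRITERIA. (i) A refutation of LiouvilleOrthogonalTC0 or DigitPolyUniformity by an explicit
digital function correlating with λ
caps the ladder at that rung: route closes as `exhausted` above it but keeps R0/R1 theorems (checked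
already: λ(y-smooth part) ∈ TC⁰ has
correlation E λ(rough part) = O(log y · e^{−c√(n/2)}) since λ·1_rough = λ ∗ (μ²·1_smooth);
residue-class and rough-indicator tests
likewise vanish — no cheap counterexample). (ii) X refuted (L_λ ∈ P/poly, e.g. factoring in P/poly)
kills the top but not S.
(iii) A proof that QuadraticDigitPhases needs zero-free regions beyond Vinogradov–Korobov (GRH-hard
rather than circuit-hard) → demote R1, keep R0.

NOT DECOMPOSED YET. Type I/II structure of WalshLiouvilleBound (Vaughan identity, carry lemmas,
large sieve) — provers attach lemmas with
--supports; the AC⁰[p] (odd p) and ACC⁰ (Beigel–Tarui SYM∘AND, machinery in SymPlusProofs) rungs;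
quantitative (2^{−n^c}) forms of the
orthogonality statements (provers may prove them; the ε-forms are what the class glue needs); the
uniform top CMR(BPP) → AvgCase
(carried from the retired sibling card mobius-randomness-engine) — a separate route if R1 moves.

NOVELTY / BARRIERS: see the route's Novelty and Barriers fields (searched 2026-08-15; nearest prior
art Green2012, Bourgain 2013 ×2,
Mullner2017, Coons2011, Sarnak 2010 Lecture 1 p. 2; technique_class analytic-number-theory,
correlation-bounds, non-natural).

Novelty: NOVELTY (searched 2026-08-15 BEFORE claiming: `lit frontier QuantumAdvantage --since 2020` (30
newest descendants: none on μ/λ),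
`lit bridges QuantumAdvantage --cross any`, zbMATH "Moebius function bounded depth circuits" (only
Green2012) / "Sarnak conjecture
computational complexity circuits" (0) / "Mobius randomness principle complexity" (de la Rue survey
only), Crossref "Möbius function
circuit lower bound threshold", "Liouville function Boolean circuit correlation" (Daboussi–Sárközy
doi:10.4064/aa108-1-6 on the
TRUNCATED Liouville function — the smooth-part observable our refutation test uses), "quantum
advantage Liouville function" (0 relevant);
full reads of arXiv:1103.4991, arXiv:1109.2784, arXiv:1112.1423, arXiv:0810.3709 and Sarnak's Three
Lectures (IAS pdf) pp. 2–3;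
OpenAlex/S2/arXiv/galaxy were rate-limited or unavailable (429 / rc 75) and are owed a re-run by the
novelty audit).
Nearest prior art: (1) Green2012 Thm 1 (μ, λ ⊥ AC⁰ via LinialMansourNisan1993; Kalai's "AC⁰ prime
number conjecture") and
Bourgain2013MoebiusWalsh Thm 1 (all Walsh coefficients < 2^{n−n^{1/10}}, "similar for Liouville"),
Bourgain2013Walsh = arXiv:1112.1423
Thm 1/Cor 2 (level ≤ n^{2/3−ε} carries o(1) mass; μ ⊥ monotone functions), Mullner2017 (μ ⊥
automatic sequences), Coons2011 Thm 1.5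
(λ not k-automatic): these ARE rungs R0 and the side rungs, proved as Möbius randomness with no
quantum class in sight.
(2) Sarnak2010ThreeLectures p. 2: tries "low complexity = P", rejects it (μ ∈ P open; p  [refs: 10.4064/aa108-1-6, 10.1017/s0963548312000284, 10.1007/s11856-013-0002-2, 10.1145/972639.972643, 1103.4991, 1109.2784, 1112.1423, 0810.3709, 2012.01920, 1602.03042, doi:10.4064/aa108-1-6, doi:10.1017/s0963548312000284, doi:10.1007/s11856-013-0002-2, doi:10.1145/972639.972643, Green2012, LinialMansourNisan1993, Mullner2017, Coons2011, NaorReingold2004, RazborovRudich1997, Tal2017]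

Barriers (technique_class: analytic-number-theory, correlation-bounds, non-natural): technique_class: analytic-number-theory, correlation-bounds, non-natural
- Literature.Barriers.QuantumAdvantage.NaturalProofs: ENGAGED at R2 and at X (TC⁰ and P/poly lower
bounds for a factoring-derived function; `NaturalProofs.no_naturalProof_fact` is the FACT version,
and TC⁰ already contains Naor–Reingold PRFs under factoring/DDH, NaorReingold2004, so a NATURAL
proof of L_λ ∉ TC⁰ would break its own premise). Evaded IN KIND, not yet in fact: the property the
engine uses — "agrees with a completely multiplicative ±1 function having PNT-type cancellation in
progressions to moduli 2^k and along digit classes" — is constructive but NOT large (a 2^{-Ω(2^n)}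
fraction of Boolean functions is close to multiplicative), so RazborovRudich1997 Thm 4.1 does not
apply to proofs by type I/II sums; R0/R1 (AC⁰, AC⁰[⊕]) lie below every PRF candidate anyway. Whether
bilinear methods can see threshold gates is the bet.
- Literature.Barriers.QuantumAdvantage.SeparationPrerequisites: applies to X only (X ⇒ summit ⇒ PP ⊄
BPP, P ≠ PSPACE; indeed X ⇒ EXP ⊄ P/poly-type consequences) and, one level down, R2 ⇒ E ⊄ TC⁰ (open;
Williams2014/MurrayWilliams2018 stop at ACC⁰). NOT evaded: X is hypothesis-type and never staffed
for proof; R2 is filed as breakthrough-type for refuters first; R0/R1 imply no uniform class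
separation.
- Literature.Barriers.QuantumAdvantage.Relativization: not engaged — every rung is an unrelativized
statement about one explicit arithmetic function against explicit circuit class

Novelty grade: new-combination — ROUTE REVIEW + grade (refuter route-review, 2026-08-15; full review attached as evidence on stmt-1389; items already pool-checked 14/14). Grade new-combination = (A) the Möbius/Liouville-randomness-versus-circuit-classes ladder of Kalai–Green–Bourgain (R0 AC⁰ IN PRINT for λ; R1 AC⁰[⊕] and R2 TC⁰ are (refuter refuter-rreview-route-QuantumAdvantage-M-4fd66191-0, 2026-08-15T12:21:09Z; prior: Green2012 arXiv:1103.4991 Thm 1 (+ p.3: holds for λ; LMN stalls at |S|≈n^{1/2}), Bourgain2013MoebiusWalsh arXiv:1109.2784 Thm 1 (+ Liouville remark), Bourgain2013Walsh arXiv:1112.1423 Thm 1 / Cor 2, Mullner2017 (μ ⊥ automatic sequences), Coons2011 arXiv:0810.3709 Thm 1.5, Sarnak2010ThreeLectures p.2, LinialMansourNisan1993 / Tal2017, Razborov1987 / Smolensky1987, Adleman1978 + Shor1997 (= closed r)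

History (route lifecycle, newest last):
- 2026-08-16T04:15:04Z · AUTO-CRUX (backfill): LiouvilleNotPPoly — hypotheses of the deciding theorem that nothing in the route derives are cruxes (operator:999:1085951)
- 2026-08-24T16:00:59Z · DORMANT — reconciler: no traction for 6.9 d (last activity item-evidence-added at 2026-08-17T18:23:07Z); parked, not closed — `ledger route dormant route-QuantumAdvantage (operator:999:2627700)

sub-problem: QuantumAdvantage · status: dormant · opened planner-plancard-QuantumAdvantage-QuantumAdva-94bb655d-0 2026-08-15T10:55:29Z · rev 4 · ledger route-QuantumAdvantage-MobiusLadder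
GENERATED by the gate from the ledger (D-0016/17). Provers cite these decls: `theorem foo : Summit.QuantumAdvantage.QuantumAdvantage.Theses.MobiusLadder.<Decl> := …` in Summits/QuantumAdvantage/QuantumAdvantage/Theorems/<Name>.lean.
-/

namespace Summit.QuantumAdvantage.QuantumAdvantage.Theses.MobiusLadder

open scoped BigOperators Topology Manifold Classical MeasureTheory ProbabilityTheory Matrix InnerProductSpace ComplexConjugate ContinuousMap
open Filter Set Function TopologicalSpace MeasureTheory

attribute [summit_statement] _root_.QuantumAdvantage

open Literature.QuantumAdvantage

/-- item stmt-QuantumAdvantage-1389 · crux (kind.auto-crux: conjecture-grade) · rank 0 · open · by planner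
why it might fail: May be FALSE: nothing excludes poly-size circuits for Ω(N) mod 2 (FACTORING ∈ P/poly open; factoring-free algorithm for λ open, AdlemanMcCurley1994, Sarnak2010 p.2). If TRUE, out of reach: L_λ ∈ NP∩coNP so X ⇒ NP ⊄ P/poly (explicit bounds ≈3.1n, LiYang2022); natural proofs barred given PRGs.
sources: AdlemanMcCurley1994, Sarnak2010ThreeLectures, RazborovRudich1997, LiYang2022, Literature.Barriers.QuantumAdvantage.NaturalProofs, Literature.Barriers.QuantumAdvantage.SeparationPrerequisites
[target] Thesis X: the Liouville language L_λ = {bin(N) : λ(N) = −1} (= Ω(N) odd; canonical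
LSB-first encodings, Mathlib encodingNatBool) has no polynomial-size B₂-circuit family.
Hypothesis-type (not expected to be proved; stronger than CircuitLB's ClbFactNotPpoly since λ is
computable from the factorisation). Top rung of the ladder; with LiouvilleMemBQP and Adleman it
gives the summit (Assembly). -/
@[route_item "route-QuantumAdvantage-MobiusLadder", crux]
def LiouvilleNotPPoly : Prop :=
  Computability.encodingNatBool.toLanguage {N : ℕ | ArithmeticFunction.liouville N = -1} ∉ Literature.Computability.Complexity.PPoly

/-- item stmt-QuantumAdvantage-1391 · crux · rank 3 · open · by planner
why it might fail: Truth only heuristic: no printed conjecture covers n-dependent digital tests (Sarnak2010 p.2; Kalai2024: degree ≥2 open). Proved cases are digit-LOCAL (MauduitRivat2015, Mullner2017, Konieczny2020, DMRS2022); mirror forms Σx_i x_{n−1−i} couple both digit ends — only sieve bounds (DartygeEtAl2024).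
sources: Kalai2024MobiusRandomness, Sarnak2010ThreeLectures, MauduitRivat2015, Mullner2017, Konieczny2020, arXiv:1808.06196
[crux] Digital quadratic uniformity of λ: for every ε > 0, for all large n and every P ∈
F₂[x_0..x_{n−1}] of total degree ≤ 2, |Σ_{N<2^n} λ(N)(−1)^{P(bits N)}| ≤ ε 2^n. Degree 1 is
WalshLiouvilleBound; digit-LOCAL quadratics (Rudin–Shapiro Σ x_i x_{i+1}, block-additive forms) are
automatic and known (MauduitRivat2015, Mullner2017); general supports — e.g. mirror forms Σ x_i
x_{n−1−i} coupling low and high digits — are open. First open case of DigitPolyUniformity and the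
natural first target of the analytic engine; provers may attach partial classes (bounded bandwidth,
bounded rank) with --supports. -/
@[route_item "route-QuantumAdvantage-MobiusLadder"]
def QuadraticDigitPhases : Prop :=
  ∀ ε : ℝ, 0 < ε → ∀ᶠ n : ℕ in Filter.atTop, ∀ P : MvPolynomial (Fin n) (ZMod 2), P.totalDegree ≤ 2 → |∑ N ∈ Finset.range (2 ^ n), ((ArithmeticFunction.liouville N : ℤ) : ℝ) * (if MvPolynomial.eval (fun i : Fin n => if Nat.testBit N i then (1 : ZMod 2) else 0) P = 1 then (-1 : ℝ) else 1)| ≤ ε * (2 : ℝ) ^ n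

/-- item stmt-QuantumAdvantage-1392 · crux · rank 4 · open · by planner
why it might fail: Open since Kalai 2011 (MO 57543; Kalai2024: only degree 1 = Bourgain 2013): no inverse theorem or type I/II engine for digital phases of growing degree (no carry-locality); Green2012 p.3: methods stall at Walsh level n^{1/2} (n/log n on GRH), may be GRH-hard; ℓ²-level data can't see bent phases.
sources: Kalai2024MobiusRandomness, Green2012, arXiv:1103.4991, Bourgain2013MoebiusWalsh, Bourgain2013Walsh, doi:10.1007/s11854-016-0012-1
[crux] Digital low-degree uniformity of λ (the AC⁰[⊕] rung's analytic heart): for every A and ε > 0,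
for all large n and every P ∈ F₂[x_0..x_{n−1}] of total degree ≤ (log₂ n)^A, |Σ_{N<2^n}
λ(N)(−1)^{P(bits N)}| ≤ ε 2^n. Exactly what the Razborov–Smolensky glue needs (support
LiouvilleNotAC0Xor: a depth-d size-s AC⁰[⊕] circuit agrees with some polynomial of degree (log₂(16
s))^d ≤ (log₂ n)^{d+1} off a 1/16 fraction). A 'Gowers-uniformity along the 2-adic digit structure'
statement; no counting obstruction (2^{(log n)^{A+1}} phases ≪ 2^{2^n}). -/
@[route_item "route-QuantumAdvantage-MobiusLadder", crux]
def DigitPolyUniformity : Prop :=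
  ∀ A : ℕ, ∀ ε : ℝ, 0 < ε → ∀ᶠ n : ℕ in Filter.atTop, ∀ P : MvPolynomial (Fin n) (ZMod 2), P.totalDegree ≤ Nat.log 2 n ^ A → |∑ N ∈ Finset.range (2 ^ n), ((ArithmeticFunction.liouville N : ℤ) : ℝ) * (if MvPolynomial.eval (fun i : Fin n => if Nat.testBit N i then (1 : ZMod 2) else 0) P = 1 then (-1 : ℝ) else 1)| ≤ ε * (2 : ℝ) ^ n

/-- item stmt-QuantumAdvantage-1393 · crux · rank 5 · open · by planner
why it might fail: May be FALSE: fails iff poly-size TC⁰ gets Ω(N) mod 2 on ≥½+δ of N<2^n i.o.; TC⁰ does division (HAB2002), so λ(n^k-smooth part) is a TC⁰ test (correlating only ≪(log n)²e^{−c√n}) and FACTORING ∈ TC⁰/poly is not excluded. If TRUE: E ⊄ TC⁰/poly-strength (frontier NQP ⊄ ACC⁰), non-natural (NR PRFs).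
sources: HesseAllenderBarrington2002, NaorReingold2004, MurrayWilliams2018, Williams2014, KaneWilliams2016, Bourgain2013Walsh
[crux] Möbius randomness for TC⁰: for every depth d, size polynomial p and ε > 0, for all large n,
every circuit C over tcBasis (∧, ∨, ¬, MAJ; negations free in acDepth) with acDepth ≤ d and size ≤
p(n) has |Σ_{N<2^n} λ(N)·sgn(C(bits N))| ≤ ε 2^n (sgn true = −1). Gives L_λ ∉ TC0 (support
LiouvilleNotTC0), the first rung not witnessed by PARITY/MAJORITY, i.e. the first genuinely
arithmetic non-uniform quantum-vs-classical separation. Breakthrough-type: filed for REFUTERS first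
(Sarnak's challenge, Three Lectures p. 2: exhibit an explicit feasible ξ correlating with μ).
Planner's test: λ(y-smooth part), rough-number indicators and residues of the rough part are
TC⁰-computable (HesseAllenderBarrington2002) but correlate only at O(log y · e^{−c√(n/2)}) since
λ·1_rough = λ ∗ (μ²·1_smooth). -/
@[route_item "route-QuantumAdvantage-MobiusLadder"]
def LiouvilleOrthogonalTC0 : Prop :=
  ∀ d : ℕ, ∀ p : Polynomial ℕ, ∀ ε : ℝ, 0 < ε → ∀ᶠ n : ℕ in Filter.atTop, ∀ C : Literature.Computability.Complexity.Circuit (Fin n), C.IsOver Literature.Computability.Complexity.tcBasis → C.acDepth ≤ d → C.size ≤ p.eval n → |∑ N ∈ Finset.range (2 ^ n), ((ArithmeticFunction.liouville N : ℤ) : ℝ) * Literature.Probability.RandomGraphs.LowDegree.sgn (C.eval (fun i : Fin n => Nat.testBit N i))| ≤ ε * (2 : ℝ) ^ n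

/-- item stmt-QuantumAdvantage-1390 · support · rank 2 · closed · proved by Summit.QuantumAdvantage.QuantumAdvantage.Theorems.MobiusLadder.walshLiouvilleBound_proof @ bd6db7cf03d5 (prover) · by planner
why it might fail: Not truth (in print) but transcription/project risk: printed proofs are for μ with λ 'similar'; Green's range needs PNT in APs mod 2^t ≤ e^{c√n} with no exceptional zero; off-by-one conventions (N < 2^n vs n ≤ 2^n, N = 0 term) must stay inside the 2^{n−n^c} slack.
sources: Bourgain2013MoebiusWalsh, arXiv:1109.2784, Green2012, arXiv:1103.4991, Literature.NumberTheory.Sieve.bourgain_liouville_walsh, Literature.NumberTheory.LFunctions.bourgain_liouville_walsh_uniform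
[crux] Bourgain's Möbius–Walsh bound in Liouville form, exponent left free: ∃ c > 0, for all large n
and every S ⊆ {0..n−1}, |Σ_{N<2^n} λ(N) w_S(bits N)| ≤ 2^{n − n^c} (w_S = the tree's `walsh S`,
digits via Nat.testBit, LSB = index 0 as in Bourgain). In print for μ with c = 1/10
(Bourgain2013MoebiusWalsh Thm 1, 'a similar estimate is also valid for the Liouville function';
small |S| < n^{1/2}: Green2012 Prop 1, 'all results hold equally well for λ'). The named fact every
rung rests on — filed as the FIRST crux by the Phase-C rule; to be EARNED in the tree (Vaughan/type
I–II sums after Mauduit–Rivat for |S| ≳ √n, Fourier expansion of w_S + L(s, χ mod 2^t) zero-free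
region incl. no exceptional zero for conductor 2^e for small |S|). A Literature named fact (cite
item filed) may replace the body later; AC0Rung consumes it. -/
@[route_item "route-QuantumAdvantage-MobiusLadder"]
def WalshLiouvilleBound : Prop :=
  ∃ c : ℝ, 0 < c ∧ ∀ᶠ n : ℕ in Filter.atTop, ∀ S : Finset (Fin n), |∑ N ∈ Finset.range (2 ^ n), ((ArithmeticFunction.liouville N : ℤ) : ℝ) * Literature.Probability.RandomGraphs.LowDegree.walsh S (fun i : Fin n => Nat.testBit N i)| ≤ (2 : ℝ) ^ ((n : ℝ) - (n : ℝ) ^ c)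

/-- item stmt-QuantumAdvantage-1394 · support · rank 6 · closed · proved by Summit.QuantumAdvantage.QuantumAdvantage.Theorems.LiouvilleOrthogonalAC0_proof @ 6d597943b774 (prover) · by planner
sources: Green2012, Bourgain2013MoebiusWalsh, Tal2017
[support] The predicate 'Möbius randomness for AC⁰': as LiouvilleOrthogonalTC0 with acBasis (∧, ∨, ¬
of any fan-in). In print (Green2012 Thm 1 + Bourgain2013MoebiusWalsh); closes unconditionally once
WalshLiouvilleBound lands via AC0Rung; stated in ε-form (what the class glue needs) — a prover may
prove the quantitative 2^{−n^{c}/polylog} form. -/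
@[route_item "route-QuantumAdvantage-MobiusLadder"]
def LiouvilleOrthogonalAC0 : Prop :=
  ∀ d : ℕ, ∀ p : Polynomial ℕ, ∀ ε : ℝ, 0 < ε → ∀ᶠ n : ℕ in Filter.atTop, ∀ C : Literature.Computability.Complexity.Circuit (Fin n), C.IsOver Literature.Computability.Complexity.acBasis → C.acDepth ≤ d → C.size ≤ p.eval n → |∑ N ∈ Finset.range (2 ^ n), ((ArithmeticFunction.liouville N : ℤ) : ℝ) * Literature.Probability.RandomGraphs.LowDegree.sgn (C.eval (fun i : Fin n => Nat.testBit N i))| ≤ ε * (2 : ℝ) ^ n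

/-- item stmt-QuantumAdvantage-1395 · support · rank 7 · closed · proved by Summit.QuantumAdvantage.QuantumAdvantage.Theorems.MobiusLadder.AC0Rung_proof (prover) · by planner
sources: Green2012, Tal2017, LinialMansourNisan1993, ODonnell2014
[support] R0, provable NOW: WalshLiouvilleBound → LiouvilleOrthogonalAC0. Proof in print = Green2012
§2 with Tal in place of LMN: E[λ·F] = Σ_S F̂(S) λ̂(S); low levels |S| ≤ K by Σ_{|S|=k}|F̂(S)| ≤ (c
ln s)^{(d−1)k} (tree, PROVED: `Literature.Computability.Complexity.Circuit.l1Level_acBasis_le`)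
times max_S |λ̂(S)| ≤ 2^{−n^c}; high levels by Cauchy–Schwarz, Parseval (`sum_cubeFourierCoeff_sq`)
and the tail bound W^{≥K}[F] ≤ 8^d 2^{−K/(B^d t ℓ^{d−2})} (tree, PROVED:
`ACForm.tailWeight_le_tailBound` + `Circuit.exists_acForm`); choose K = n^{c}/(2(d−1) log₂(c ln s)).
Bridge: sgn ∘ C.eval and `cubeFourierCoeff`/`walsh` of Literature.Computability.Complexity.LowDegree
(BooleanFourier.lean). -/
@[route_item "route-QuantumAdvantage-MobiusLadder"]
def AC0Rung : Prop :=
  WalshLiouvilleBound → LiouvilleOrthogonalAC0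

/-- item stmt-QuantumAdvantage-1396 · support · rank 8 · closed · proved by Summit.QuantumAdvantage.QuantumAdvantage.Theorems.MobiusLadder.LiouvilleNotAC0_proof @ 7ac08aa6932c (prover) · by planner
sources: Green2012, AroraBarakCC2009
[support] Class glue, elementary and provable NOW: LiouvilleOrthogonalAC0 → L_λ ∉ AC0. If a family
(C_n) over acBasis of depth d, size p(n) decides L_λ, then on the padded digits of N < 2^n the
circuit C_n computes g(N) = [N ≥ 2^{n−1} ∧ λ(N) = −1] (strings with top bit 0 are not codewords:
encodeNat ends in `true`, encodeNat 0 = []); hence Σ_{N<2^n} λ(N) sgn(g N) = 2^{n−1} + Σ_{N<2^{n−1}}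
λ(N) ≥ 2^{n−2}, because the disjoint pairs (m, 2m), m odd < 2^{n−2}, carry opposite signs (λ(2m) =
−λ(m), Mathlib `liouville_apply_mul`/completely multiplicative) so |Σ_{N<2^{n−1}} λ| ≤ 2^{n−2};
contradiction with ε = 1/8. No PNT needed. -/
@[route_item "route-QuantumAdvantage-MobiusLadder"]
def LiouvilleNotAC0 : Prop :=
  LiouvilleOrthogonalAC0 → Computability.encodingNatBool.toLanguage {N : ℕ | ArithmeticFunction.liouville N = -1} ∉ Literature.Computability.Complexity.AC0

/-- item stmt-QuantumAdvantage-1397 · support · rank 9 · closed · proved by Summit.QuantumAdvantage.QuantumAdvantage.Theorems.MobiusLadder.LiouvilleNotAC0Xor_proof @ 3f3529ed4a81 (prover) · by planner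
sources: Razborov1987, Smolensky1987, AroraBarakCC2009
[support] R1 glue (Razborov–Smolensky), provable: DigitPolyUniformity → L_λ ∉ AC0Mod 2. For a
depth-d size-s circuit over accBasis 2 (MOD₂ = parity, exact degree 1; ∧/∨ of fan-in k replaced by 1
− Π_{j≤ℓ}(1 − Σ_{i∈R_j} x_i) over random subsets; ¬ by 1 + p) there is, for each n, a FIXED
F₂-polynomial of degree ≤ ℓ^d agreeing with C_n off a fraction s·2^{−ℓ} of inputs (average the
pointwise error bound); take ℓ = log₂(16 s(n)) so degree ≤ (log₂ n)^{d+1} eventually and error ≤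
1/16; then |Σ λ(−1)^P| ≥ Σ λ sgn(C_n) − 2^n/8 ≥ 2^{n−2} − 2^{n−3} (the LiouvilleNotAC0 computation)
contradicts DigitPolyUniformity with A = d+1, ε = 1/16. Probabilistic-polynomial machinery for OR
already lives in Literature/Computability/Complexity/SymPlusProofs.lean (Beigel–Tarui). -/
@[route_item "route-QuantumAdvantage-MobiusLadder"]
def LiouvilleNotAC0Xor : Prop :=
  DigitPolyUniformity → Computability.encodingNatBool.toLanguage {N : ℕ | ArithmeticFunction.liouville N = -1} ∉ Literature.Computability.Complexity.AC0Mod 2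

/-- item stmt-QuantumAdvantage-1398 · support · rank 10 · closed · proved by Summit.QuantumAdvantage.QuantumAdvantage.Theorems.MobiusLadder.LiouvilleNotTC0_proof @ d0c8d461ed3e (prover) · by planner
sources: AroraBarakCC2009
[support] Class glue, elementary: LiouvilleOrthogonalTC0 → L_λ ∉ TC0, verbatim the LiouvilleNotAC0
argument over tcBasis. -/
@[route_item "route-QuantumAdvantage-MobiusLadder"]
def LiouvilleNotTC0 : Prop :=
  LiouvilleOrthogonalTC0 → Computability.encodingNatBool.toLanguage {N : ℕ | ArithmeticFunction.liouville N = -1} ∉ Literature.Computability.Complexity.TC0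

/-- item stmt-QuantumAdvantage-1399 · support · rank 11 · closed · proved by Summit.QuantumAdvantage.QuantumAdvantage.Theorems.MobiusLadder.LiouvilleLangNotRegular_proof @ 70574dc58a5e (prover) · by planner
sources: Coons2011, arXiv:0810.3709, Mullner2017, KoniecznyLemanczykMullner2021
[support] The automatic rung (in print; asked for by the card's novelty audit): L_λ is not a regular
language, i.e. λ (equivalently Ω mod 2) is not 2-automatic — Coons2011 Thm 1.5 / Cor 1.7 (via
Allouche–Mendès France–Peyrière meromorphy of automatic Dirichlet series, PNT and Selberg's
positive-proportion theorem: ζ(2s)/ζ(s) has ≫ T log T poles); alternatively Mullner2017 (μ ⊥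
automatic sequences) or the classification of (completely) multiplicative automatic sequences
(KoniecznyLemanczykMullner2021). Regularity of the LSB-first canonical encodings = 2-automaticity
(regular languages are closed under reversal and under intersection with the codeword set). A rung
incomparable with AC⁰ (REG ∋ PARITY). -/
@[route_item "route-QuantumAdvantage-MobiusLadder"]
def LiouvilleLangNotRegular : Prop :=
  ¬ (Computability.encodingNatBool.toLanguage {N : ℕ | ArithmeticFunction.liouville N = -1}).IsRegular

/-- item stmt-QuantumAdvantage-1400 · support · rank 12 · closed · proved by Summit.QuantumAdvantage.QuantumAdvantage.Theorems.MobiusLadder.LiouvilleMemBQP_proof @ dce0376ec6d5 (prover) · by planner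
sources: Shor1997, BernsteinVazirani1997
[support] L_λ ∈ BQP (the quantum half of every rung and of the Assembly). Closes from route Shor's
item stmt-QuantumAdvantage-0233 (`Literature.Computability.Cryptography.factoring_mem_FBQP`,
Shor1997 §5) through ShorToLiouville; not provable before Shor's theorem is earned. λ is TOTAL, so
this is a language, not a promise problem. -/
@[route_item "route-QuantumAdvantage-MobiusLadder", crux]
def LiouvilleMemBQP : Prop :=
  Computability.encodingNatBool.toLanguage {N : ℕ | ArithmeticFunction.liouville N = -1} ∈ Literature.Computability.Cryptography.BQP

/-- item stmt-QuantumAdvantage-1401 · support · rank 13 · closed · proved by Summit.QuantumAdvantage.QuantumAdvantage.Theorems.MobiusLadder.shorToLiouville_proof @ 373a644d5806 (prover) · by planner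
sources: Shor1997, Watrous2009, BernsteinVazirani1997
[support] Provable NOW (infrastructure, same as route Shor's ShorFBQPToFACT
stmt-QuantumAdvantage-0234): `Literature.Computability.Cryptography.factoring_mem_FBQP → L_λ ∈ BQP`
— run the FBQP family, fold the classical post-processing into the uniform Clifford+T family: reject
unless the input is a codeword (last bit true; [] encodes 0 and λ(0) = 0 ≠ −1), else accept iff the
decoded factor list has odd length (Ω(N) odd ⇔ liouville N = −1 for N ≠ 0, Mathlib
`ArithmeticFunction.liouville_apply`, `cardFactors`), keeping error ≤ 1/3. -/
@[route_item "route-QuantumAdvantage-MobiusLadder"]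
def ShorToLiouville : Prop :=
  Literature.Computability.Cryptography.factoring_mem_FBQP → LiouvilleMemBQP

/-- item stmt-QuantumAdvantage-1402 · assembly · rank 1 · closed · proved by Summit.QuantumAdvantage.QuantumAdvantage.Theorems.MobiusLadder.Assembly_proof @ e8a994f95889 (prover) · by planner
sources: Adleman1978, AroraBarakCC2009
[assembly] LiouvilleMemBQP → LiouvilleNotPPoly → QuantumAdvantage: if no BQP language left BPP then
L_λ ∈ BQP ⊆ BPP ⊆ P/poly (Adleman, PROVED in the tree:
`Literature.Computability.Complexity.BPP_subset_PPoly_holds`), contradicting X. One line, by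
contradiction on the existential summit; proof term checked in the planner's Sketch.lean: `fun hBQP
hX => by_contra h; exact hX (BPP_subset_PPoly_holds (by_contra fun hL => h ⟨_, hBQP, hL⟩))`. -/
@[route_item "route-QuantumAdvantage-MobiusLadder"]
def Assembly : Prop :=
  LiouvilleMemBQP → LiouvilleNotPPoly → QuantumAdvantage

/-! D-0027 §2.1 — DECIDING THEOREM (planner-authored via `route open/edit --closes-file`; by planner-rbadge-QuantumAdvantage-MobiusLadder-b3d87ef1-g2-0 2026-08-15T16:13:21Z):
its hypotheses are this route's items and its conclusion the sub-problem Statement (glue_lint), and it elaborates with this file. -/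

@[closes "route-QuantumAdvantage-MobiusLadder"] theorem closes (h₁ : LiouvilleMemBQP) (h₂ : LiouvilleNotPPoly) : QuantumAdvantage := by
  by_contra h
  exact h₂ (Literature.Computability.Complexity.BPP_subset_PPoly_holds
    (by_contra fun hL => h ⟨_, h₁, hL⟩))

end Summit.QuantumAdvantage.QuantumAdvantage.Theses.MobiusLadder
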